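import Summits.QuantumFields.BalabanUV.T4Continuum.Support.NE7PlaqGradDictionary
import HarnessLib

/-!
# NE7PlaqGradDictionaryLocal — THE PLAQUETTE-GRADIENT DICTIONARY WITH POINTWISE HYPOTHESES: the covariant `τ`-gradient of the `(κ, μ)`-plaquette of ANY
# configuration `W` whose eight bonds around `q`, `q + e_τ` are exponentials `e^{A(b)}` is `≤ 2a₂ + 4(e^{4ρ} − 1)a₁ + 2w_τ·x`, where `ρ`, `a₁`, `a₂` bound
# those eight exponents, their four `τ`-differences and the two second differences, `w_τ = ‖W(q,τ) − 1‖`, `x = ‖W(∂p(q+e_τ)) − 1‖` — the form a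
# cube-by-cube gauge ([Balaban1985Variational] Thm 1 (9)) needs

Cell `pub-balaban`, rung (B)+1 sub-cell t4, lineage `b2b-balaban-t4-ne7-p1` (CRUX PROVER NE7 #1 = OWNER of row NE7), generation 91; memo
`t4/b2b-balaban-t4-ne7-p1-g91/COVER-OBSTRUCTION.md` §5.  Over F293 `NE7PlaqGradDictionary` (global form) and `NE7GradientCurrency.norm_plaqRem_sub_plaqRem_le`.

WHY.  [B11] Thm 1 (9) gives the gauge `U^{u} = e^{A}` only on a neighbourhood of a cube; (PG) is pointwise.  So the dictionary must read `A` only on the bonds of the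
two plaquettes `∂p_{κμ}(q)`, `∂p_{κμ}(q + e_τ)`: this file states it with exactly those eight bond identities and pointwise letters (no global hypothesis on `A` or
`W`), via `B7Prop1Local.hol_plaqWord_eq`.  With F289 `norm_plaqGradDir_gaugeAct` (gauge invariance of the datum) the successor applies it to `W = U^{u}` cube by cube.
WHAT ([folklore]; 0 def, 0 sorry).  **`norm_plaqGradDir_le_local`**.
HONEST FRAMING (page 1): kinematics; (PG) NOT proved (needs the letters of the minimiser, [B11] Thm 1 (9) TYPE); NE7 NOT PROVED; nothing of Bałaban's asserted;
spine 0∕9; finite T⁴ rung (B)+1 — NOT infinite volume, NOT mass gap, NOT `BetaPertH`, NOT Clay.  Continuum YM on T⁴ ⇐ BetaPertH ∧ nine spine estimates (0/9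
proved); BetaPertH ⇐ (D1) ∧ (D4) ∧ CAP+tail; G-an2-4 gates asym, D1 and NE2/3/4.  No `sorry`; axioms ⊆ {propext, Classical.choice, Quot.sound}.  PLACEMENT: our
lemma, under `Summits/QuantumFields/BalabanUV/`.
-/

set_option autoImplicit false

open scoped BigOperators Matrix Matrix.Norms.L2Operator
open NormedSpace Finset

namespace Summit.QuantumFields.BalabanUV.T4Continuum.NE7PlaqGradDictionaryLocal

open Literature.MathematicalPhysics.QuantumFieldTheory.Balaban1983to89
open B7Prop1Explicit B7Prop2Explicit
open B7Prop1Local (hol_plaqWord_eq)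
open T4AveragingDeficitWall (Ad IsUnitaryCfg)
open NE3LadderCovariantDifference (norm_Ad_sub_le_of_sub_one)
open NE7GradientCurrency (norm_plaqRem_sub_plaqRem_le)
open NE7PlaqGradDictionary (flatCurl_shift_eq)

noncomputable section

variable {d : ℕ} {n : Type*} [Fintype n] [DecidableEq n]

/-- **THE PLAQUETTE-GRADIENT DICTIONARY, POINTWISE.**  Let `W` be unitary and `A` any bond field such that the eight bonds of the plaquettes `∂p_{κμ}(q)` and
`∂p_{κμ}(q + e_τ)` read `W(b) = e^{A(b)}`; let `ρ` bound those eight exponents, `a₁` their four `τ`-differences, `a₂` the two second differences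
`∂_μ∂_τA_κ(q)`, `∂_κ∂_τA_μ(q)`, `w_τ ≥ ‖W(q,τ) − 1‖` and `x ≥ ‖W(∂p_{κμ}(q+e_τ)) − 1‖`.  Then
`‖Ad_{W(q,τ)}W(∂p_{κμ}(q+e_τ)) − W(∂p_{κμ}(q))‖ ≤ 2a₂ + 4(e^{4ρ} − 1)a₁ + 2w_τ·x`. [folklore] -/
theorem norm_plaqGradDir_le_local [Nonempty n] {W : Site d → Fin d → (Matrix n n ℂ)ˣ} (hWu : IsUnitaryCfg W) (A : Site d → Fin d → Matrix n n ℂ)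
    (q : Site d) (τ κ μ : Fin d)
    (h1 : W q κ = expUnit (A q κ)) (h2 : W (q + e κ) μ = expUnit (A (q + e κ) μ))
    (h3 : W (q + e μ) κ = expUnit (A (q + e μ) κ)) (h4 : W q μ = expUnit (A q μ))
    (h1' : W (q + e τ) κ = expUnit (A (q + e τ) κ)) (h2' : W (q + e τ + e κ) μ = expUnit (A (q + e τ + e κ) μ))
    (h3' : W (q + e τ + e μ) κ = expUnit (A (q + e τ + e μ) κ)) (h4' : W (q + e τ) μ = expUnit (A (q + e τ) μ))
    {ρ a₁ a₂ wτ x : ℝ}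
    (hρ : ‖A q κ‖ ≤ ρ ∧ ‖A (q + e κ) μ‖ ≤ ρ ∧ ‖A (q + e μ) κ‖ ≤ ρ ∧ ‖A q μ‖ ≤ ρ ∧
      ‖A (q + e τ) κ‖ ≤ ρ ∧ ‖A (q + e τ + e κ) μ‖ ≤ ρ ∧ ‖A (q + e τ + e μ) κ‖ ≤ ρ ∧ ‖A (q + e τ) μ‖ ≤ ρ)
    (ha₁ : ‖A (q + e τ) κ - A q κ‖ ≤ a₁ ∧ ‖A (q + e τ + e κ) μ - A (q + e κ) μ‖ ≤ a₁ ∧ ‖A (q + e τ + e μ) κ - A (q + e μ) κ‖ ≤ a₁ ∧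
      ‖A (q + e τ) μ - A q μ‖ ≤ a₁)
    (ha₂ : ‖(A (q + e μ + e τ) κ - A (q + e μ) κ) - (A (q + e τ) κ - A q κ)‖ ≤ a₂ ∧
      ‖(A (q + e κ + e τ) μ - A (q + e κ) μ) - (A (q + e τ) μ - A q μ)‖ ≤ a₂)
    (hwτ : ‖((W q τ : (Matrix n n ℂ)ˣ) : Matrix n n ℂ) - 1‖ ≤ wτ)
    (hx : ‖((hol W (q + e τ) (plaqWord κ μ) : (Matrix n n ℂ)ˣ) : Matrix n n ℂ) - 1‖ ≤ x) :
    ‖Ad (W q τ) ((hol W (q + e τ) (plaqWord κ μ) : (Matrix n n ℂ)ˣ) : Matrix n n ℂ) - ((hol W q (plaqWord κ μ) : (Matrix n n ℂ)ˣ) : Matrix n n ℂ)‖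
      ≤ 2 * a₂ + 4 * (Real.exp (4 * ρ) - 1) * a₁ + 2 * wτ * x := by
  obtain ⟨r1, r2, r3, r4, r1', r2', r3', r4'⟩ := hρ
  obtain ⟨e1, e2, e3, e4⟩ := ha₁
  obtain ⟨s1, s2⟩ := ha₂
  set P' : Matrix n n ℂ := ((hol W (q + e τ) (plaqWord κ μ) : (Matrix n n ℂ)ˣ) : Matrix n n ℂ) with hP'
  set P : Matrix n n ℂ := ((hol W q (plaqWord κ μ) : (Matrix n n ℂ)ˣ) : Matrix n n ℂ) with hP
  -- the transport term
  have t1 : ‖Ad (W q τ) P' - P'‖ ≤ 2 * wτ * x := by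
    refine (norm_Ad_sub_le_of_sub_one (hWu q τ) P').trans ?_
    have h0 : 0 ≤ ‖((W q τ : (Matrix n n ℂ)ˣ) : Matrix n n ℂ) - 1‖ := norm_nonneg _
    have h1 : 0 ≤ ‖P' - 1‖ := norm_nonneg _
    nlinarith [mul_le_mul hwτ hx h1 ((norm_nonneg _).trans hwτ)]
  -- the two plaquettes as four-factor products of exponentials
  have hPeq : P = exp (A q κ) * exp (A (q + e κ) μ) * exp (-A (q + e μ) κ) * exp (-A q μ) := by
    rw [hP, hol_plaqWord_eq, h1, h2, h3, h4]
    simp only [Units.val_mul, val_inv_expUnit, val_expUnit]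
  have hP'eq : P' = exp (A (q + e τ) κ) * exp (A (q + e τ + e κ) μ) * exp (-A (q + e τ + e μ) κ) * exp (-A (q + e τ) μ) := by
    rw [hP', hol_plaqWord_eq, h1', h2', h3', h4']
    simp only [Units.val_mul, val_inv_expUnit, val_expUnit]
  have hn : ∀ {X : Matrix n n ℂ}, ‖X‖ ≤ ρ → ‖-X‖ ≤ ρ := fun h => by rwa [norm_neg]
  have hrem := norm_plaqRem_sub_plaqRem_le r1' r2' (hn r3') (hn r4') r1 r2 (hn r3) (hn r4)
  -- the four first differences
  have d3 : ‖-A (q + e τ + e μ) κ - -A (q + e μ) κ‖ ≤ a₁ := by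
    rw [show -A (q + e τ + e μ) κ - -A (q + e μ) κ = -(A (q + e τ + e μ) κ - A (q + e μ) κ) by abel, norm_neg]; exact e3
  have d4 : ‖-A (q + e τ) μ - -A q μ‖ ≤ a₁ := by
    rw [show -A (q + e τ) μ - -A q μ = -(A (q + e τ) μ - A q μ) by abel, norm_neg]; exact e4
  -- the flat-curl shift: two second differences
  have hS : ‖(A (q + e τ) κ + A (q + e τ + e κ) μ + -A (q + e τ + e μ) κ + -A (q + e τ) μ) - (A q κ + A (q + e κ) μ + -A (q + e μ) κ + -A q μ)‖ ≤ 2 * a₂ := by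
    rw [flatCurl_shift_eq]
    refine (norm_add_le _ _).trans ?_
    rw [norm_neg]
    linarith
  -- assemble
  have he0 : 0 ≤ Real.exp (4 * ρ) - 1 := by
    have hρ0 : 0 ≤ ρ := (norm_nonneg _).trans r1
    nlinarith [Real.add_one_le_exp (4 * ρ)]
  have hsplit : Ad (W q τ) P' - P = (Ad (W q τ) P' - P')
      + ((A (q + e τ) κ + A (q + e τ + e κ) μ + -A (q + e τ + e μ) κ + -A (q + e τ) μ) - (A q κ + A (q + e κ) μ + -A (q + e μ) κ + -A q μ))
      + ((exp (A (q + e τ) κ) * exp (A (q + e τ + e κ) μ) * exp (-A (q + e τ + e μ) κ) * exp (-A (q + e τ) μ) - 1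
            - (A (q + e τ) κ + A (q + e τ + e κ) μ + -A (q + e τ + e μ) κ + -A (q + e τ) μ))
          - (exp (A q κ) * exp (A (q + e κ) μ) * exp (-A (q + e μ) κ) * exp (-A q μ) - 1 - (A q κ + A (q + e κ) μ + -A (q + e μ) κ + -A q μ))) := by
    rw [← hPeq, ← hP'eq]; abel
  rw [hsplit]
  refine (norm_add₃_le).trans ?_
  have hrem' := hrem.trans (mul_le_mul_of_nonneg_left (show ‖A (q + e τ) κ - A q κ‖ + ‖A (q + e τ + e κ) μ - A (q + e κ) μ‖
      + ‖-A (q + e τ + e μ) κ - -A (q + e μ) κ‖ + ‖-A (q + e τ) μ - -A q μ‖ ≤ 4 * a₁ by linarith) he0)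
  linarith

end

end Summit.QuantumFields.BalabanUV.T4Continuum.NE7PlaqGradDictionaryLocal
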